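import Literature.Probability.LatticeModels.EdgeKilledAnnulusManeuver
import Literature.Probability.LatticeModels.KilledHarmonicRatio
import HarnessLib

/-!
# Multi-scale weak Beurling for the edge-killed walk

Topic `Literature/Probability/LatticeModels` (continuation of `EdgeKilledAnnulusManeuver.lean`).
Iterating the one-annulus estimate `JordanDomain.edgeKilled_survive_le` over the scales
`k, 5k, 5²k, …` with the analytic strong Markov property (`edgeSurvive_le_mul_of_subset`, from the
ratio hull principle of `KilledHarmonicRatio.lean`): if a boundary point of the Jordan domain `D`
lies in the open box of radius `12k` about `c` on the mesh `δℤ²`, then from every site of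
`mB c k` the edge-killed walk `Ω^δ` leaves the box of radius `48·5^J k` alive with probability at
most `(1 - c_*)^(J+1)` (`JordanDomain.edgeKilled_survive_le_pow`) — the weak Beurling estimate
`P ≤ const·(r/R)^β`, `β = -log(1-c_*)/log 5`, at all scales down to the lattice.

Everything is proved. [cite: Smirnov2010, Lemma B.2; Chelkak2016, Lemma 2.13]
-/

noncomputable section

/-! ## Multi-scale weak Beurling for the edge-killed walk -/

namespace Literature.Probability.LatticeModels

open Set SimpleGraph Metric
open Literature.Probability.RandomPlanarGeometry (JordanDomain)

section MultiScale

open scoped Classical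

variable {Gr : SimpleGraph (Site 2)}

/-- **Analytic strong Markov property for survival.** If `W ⊆ W'` are finite then on `W` the
probability of leaving `W'` alive is at most (probability of leaving `W` alive) × (its maximum over
the exit set of `W`). [folklore] -/
theorem edgeSurvive_le_mul_of_subset {W W' : Set (Site 2)} (hW : W.Finite) (hW' : W'.Finite) (hWW' : W ⊆ W')
    {M : ℝ} (hM : ∀ w ∈ killedOuterBoundary Gr W, edgeSurvive Gr W' w ≤ M) :
    ∀ z ∈ W, edgeSurvive Gr W' z ≤ M * edgeSurvive Gr W z := by
  have h1 : IsKilledHarmonicOn Gr (edgeSurvive Gr W') W := (killedHarmExt_harmonicOn hW' _).mono hWW'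
  have h2 : IsKilledHarmonicOn Gr (edgeSurvive Gr W) W := killedHarmExt_harmonicOn hW _
  refine h1.le_mul_of_forall_boundary hW h2 fun w hw => ?_
  rw [show edgeSurvive Gr W w = 1 from edgeSurvive_of_not_mem hw.1, mul_one]
  exact hM w hw

/-- Exit points of the box `mW c k` lie in the start box of the next scale `mB c (5k)`. [folklore] -/
theorem killedOuterBoundary_mW_subset_mB (c : Site 2) {k : ℕ} (hk : 0 < k) :
    killedOuterBoundary Gr (mW c k) ⊆ mB c (5 * k) := by
  rintro w ⟨-, v, hv, e, rfl, -⟩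
  obtain ⟨h0, h1⟩ := hv
  have he0 := SRW.abs_stepVec_apply_le e 0
  have he1 := SRW.abs_stepVec_apply_le e 1
  simp only [mB, Set.mem_setOf_eq, Pi.add_apply]
  rw [abs_le] at h0 h1 he0 he1 ⊢
  rw [abs_le]
  push_cast
  constructor <;> constructor <;> omega

/-- The box `mW c k` lies in `mW c (5k)`. [folklore] -/
theorem mW_subset_mW_five (c : Site 2) (k : ℕ) : mW c k ⊆ mW c (5 * k) := by
  rintro w ⟨h0, h1⟩
  refine ⟨h0.trans ?_, h1.trans ?_⟩ <;> push_cast <;> nlinarith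

/-- **Multi-scale weak Beurling for the edge-killed walk.** If a boundary point `p ∈ ∂D` lies in
the open box of radius `12k` about `c` (read on `δℤ²`), then from every site of `mB c k` the
edge-killed walk leaves the box `mW c (5^J k)` of radius `48·5^J k` alive with probability at most
`(1 - c_*)^(J+1)`. [cite: Smirnov2010, Lemma B.2; Chelkak2016, Lemma 2.13] -/
theorem _root_.Literature.Probability.RandomPlanarGeometry.JordanDomain.edgeKilled_survive_le_pow
    (D : JordanDomain) {δ : ℝ} (hδ : 0 < δ) {p : ℂ} (hp : p ∈ frontier D.carrier) :
    ∀ (J : ℕ) (c : Site 2) (k : ℕ), 0 < k → |p.re / δ - c 0| < 12 * k → |p.im / δ - c 1| < 12 * k →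
      ∀ x ∈ mB c k, edgeSurvive (discreteDomainGraph D.carrier δ) (mW c (5 ^ J * k)) x ≤ (1 - maneuverConst) ^ (J + 1) := by
  intro J
  induction J with
  | zero =>
    intro c k hk hp0 hp1 x hx
    rw [pow_zero, one_mul, zero_add, pow_one]
    exact D.edgeKilled_survive_le hδ hk hp hp0 hp1 hx
  | succ J ih =>
    intro c k hk hp0 hp1 x hx
    have hk5 : 0 < 5 * k := by omega
    have hk' : (0 : ℝ) < k := by exact_mod_cast hk
    -- the induction hypothesis at scale `5k`, on the exit set of `mW c k`
    have hM : ∀ w ∈ killedOuterBoundary (discreteDomainGraph D.carrier δ) (mW c k),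
        edgeSurvive (discreteDomainGraph D.carrier δ) (mW c (5 ^ (J + 1) * k)) w ≤ (1 - maneuverConst) ^ (J + 1) := by
      intro w hw
      have := ih c (5 * k) hk5 (by push_cast; linarith) (by push_cast; linarith) w (killedOuterBoundary_mW_subset_mB c hk hw)
      rwa [pow_succ, mul_assoc]
    have hsub : mW c k ⊆ mW c (5 ^ (J + 1) * k) := by
      have : ∀ n : ℕ, mW c k ⊆ mW c (5 ^ n * k) := by
        intro n; induction n with
        | zero => simp
        | succ n ihn => exact ihn.trans (by rw [pow_succ, mul_comm (5 ^ n) 5, mul_assoc]; exact mW_subset_mW_five c _)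
      exact this (J + 1)
    have key := edgeSurvive_le_mul_of_subset (mW_finite c k) (mW_finite c _) hsub hM x (mB_subset_mW hx)
    have h0 := D.edgeKilled_survive_le hδ hk hp hp0 hp1 hx
    have hc0 : 0 ≤ (1 - maneuverConst) ^ (J + 1) := pow_nonneg (by linarith [maneuverConst_le_one]) _
    calc edgeSurvive (discreteDomainGraph D.carrier δ) (mW c (5 ^ (J + 1) * k)) x
        ≤ (1 - maneuverConst) ^ (J + 1) * edgeSurvive (discreteDomainGraph D.carrier δ) (mW c k) x := key
      _ ≤ (1 - maneuverConst) ^ (J + 1) * (1 - maneuverConst) := mul_le_mul_of_nonneg_left h0 hc0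
      _ = (1 - maneuverConst) ^ (J + 1 + 1) := by rw [pow_succ _ (J + 1)]

end MultiScale

end Literature.Probability.LatticeModels
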